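import Literature.MathematicalPhysics.KineticTheory.RegularStationaryState
import Literature.Analysis.FunctionSpaces.PoissonMappingHomeomorph
import Mathlib.MeasureTheory.Measure.Lebesgue.EqHaar
import Mathlib.Analysis.Normed.Module.Ball.Pointwise
import HarnessLib

/-!
# `StressStrongMixing` · line `birth`, stub F1 `stub_diluteGibbsDensityOne` (infrastructure 1/2):
# spatial dilation of hard-sphere Gibbs (DLR) states

Support file for the crux item stmt-AtomisticToContinuum-9584 (`StressStrongMixing`, route
`MourreKoopmanCharges` of `AtomisticToContinuum/HydrodynamicLimit`), serving the registered stub F1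
`stub_diluteGibbsDensityOne` of the skeleton `Cruxes/StressStrongMixing/Lines/birth.lean` (a
translation-invariant DLR state of the hard-sphere gas at diameter `σ` of density one).  The only source
of infinite-volume hard-sphere Gibbs states in the tree is the (unproved) named fact
`RuelleDiluteHardSphereGas`, stated at UNIT diameter; this file supplies the missing change of scale,
in every dimension `d`.

The spatial dilation `(q, v) ↦ (c q, v)` of the one-particle phase space `ℝᵈ × ℝᵈ` (positions scaled,
velocities untouched) is any homeomorphism `D` with `D p = (c • p.1, p.2)` — concretely
`(Homeomorph.smulOfNeZero c hc).prodCongr (Homeomorph.refl _)`, for which the hypothesis `hD` below is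
`fun _ => rfl`; it acts on configurations by the tree's `PointConfig.mapHomeomorph D`.  No new
definition is introduced (all statements are parametrised by `D`, `hD`).

* `hardCoreIn_mapHomeomorph_dilate_iff`, `superposeIn_mapHomeomorph_dilate`: the hard core of diameter
  `c ε` in the window `Λ` after dilation is the hard core of diameter `ε` in `c⁻¹Λ` before;
* `maxwellPhaseMeasure_eq_smul_map_dilate`, `pi_maxwellPhaseMeasure_eq_smul_map_dilate`: the a-priori
  measure `dq|_Λ ⊗ M_β(v - u)dv` is `|c|ᵈ` times the image of `dq|_{c⁻¹Λ} ⊗ M_β dv` (Lebesgue scaling,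
  `Measure.addHaar_preimage_smul`), and its `k`-fold power picks up `|c|^{dk}`;
* `gibbsWeight_mapHomeomorph_dilate`, `gibbsSpec_mapHomeomorph_dilate`: the grand-canonical weights and
  the specification are dilation covariant once the Jacobian is absorbed into the activity,
  `W^{cε, z}_Λ(A | cY) = W^{ε, cᵈz}_{c⁻¹Λ}(c⁻¹A | Y)`;
* `isHardSphereGibbs_map_dilate`: the image under `x ↦ c x` of a Gibbs state of diameter `ε` and
  activity `cᵈ z` is a Gibbs state of diameter `c ε` and activity `z` (same `β`, `u`);
  `isHardSphereGibbs_map_dilate_fin3` (REGISTERED helper stub) is the case `d = 3`, and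
  `IsHardSphereGibbs.map_dilate` the form `z ↦ z / cᵈ`;
* `isTranslationInvariant_map_dilate`: dilation preserves translation invariance.

The density of the dilated state (`density (μ ∘ (c·)⁻¹) = c⁻ᵈ density μ`, via the intensity measure and
uniqueness of Haar measure) and the assembly of F1 from `RuelleDiluteHardSphereGas` are in the companion
file `…StressStrongMixingDiluteGibbsDensityOne.lean`.  The pattern imitated is the swap covariance of the
planar hard-disc specification (`Literature/Barriers/AtomisticToContinuum/HardDiskSwapSymmetry.lean`,
`weight_mapSwap`, `IsGibbs.map_swap`), with the non-unimodular Jacobian as the new ingredient.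

References: D. Ruelle, *Statistical Mechanics: Rigorous Results* (1969), §3.4.1 (reduced variables; the
hard-sphere gas depends on `z`, `ε` only through `z εᵈ`); H.-O. Georgii, *Gibbs Measures and Phase
Transitions*, 2nd ed. (2011), Remark (5.10) (images of specifications under symmetries).
-/

noncomputable section

open MeasureTheory Set Function Filter Topology
open scoped ENNReal NNReal

namespace Summit.AtomisticToContinuum.HydrodynamicLimit.Theorems.MourreKoopmanChargesStressStrongMixing

open Literature.Analysis.FunctionSpaces Literature.Analysis.FluidPDE

variable {d : Type*} [Fintype d] {c : ℝ}
  {D : EuclideanSpace ℝ d × EuclideanSpace ℝ d ≃ₜ EuclideanSpace ℝ d × EuclideanSpace ℝ d}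

/-! ## The dilation of phase space and of configurations -/

omit [Fintype d] in
/-- A spatial dilation is additive (it is linear). -/
theorem dilate_add (hD : ∀ p, D p = (c • p.1, p.2)) (p q : EuclideanSpace ℝ d × EuclideanSpace ℝ d) :
    D (p + q) = D p + D q := by
  rw [hD, hD, hD]
  ext1 <;> simp [smul_add]

/-- Positions of dilated particles are at `|c|` times their distance. -/
theorem norm_dilate_fst_sub (hD : ∀ p, D p = (c • p.1, p.2)) (p q : EuclideanSpace ℝ d × EuclideanSpace ℝ d) :
    ‖(D p).1 - (D q).1‖ = |c| * ‖p.1 - q.1‖ := by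
  rw [hD, hD, ← smul_sub, norm_smul, Real.norm_eq_abs]

omit [Fintype d] in
/-- The spatial window seen by a dilated configuration: `D⁻¹(Λ × ℝᵈ) = (c⁻¹Λ) × ℝᵈ`, at the level of
preimages. -/
theorem preimage_dilate_fst_preimage (hD : ∀ p, D p = (c • p.1, p.2)) (Λ : Set (EuclideanSpace ℝ d)) :
    D ⁻¹' (Prod.fst ⁻¹' Λ) = Prod.fst ⁻¹' ((c • ·) ⁻¹' Λ) := by
  ext p
  simp only [Set.mem_preimage, hD]

/-- **The hard core is dilation covariant**: the dilated configuration `c X` satisfies the hard-core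
constraint of diameter `c ε` in the window `Λ` iff `X` satisfies the constraint of diameter `ε` in the
window `c⁻¹ Λ` (`c > 0`). -/
theorem hardCoreIn_mapHomeomorph_dilate_iff (hc : 0 < c) (hD : ∀ p, D p = (c • p.1, p.2)) (ε : ℝ)
    (Λ : Set (EuclideanSpace ℝ d)) (X : PointConfig (EuclideanSpace ℝ d × EuclideanSpace ℝ d)) :
    HardCoreIn (c * ε) Λ (X.mapHomeomorph D) ↔ HardCoreIn ε ((c • ·) ⁻¹' Λ) X := by
  have hwin : ∀ p : EuclideanSpace ℝ d × EuclideanSpace ℝ d, (D p).1 ∈ Λ ↔ p.1 ∈ (c • ·) ⁻¹' Λ :=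
    fun p => by rw [hD]; rfl
  constructor
  · intro h p hp q hq hpq hΛ
    have hp' : D p ∈ X.mapHomeomorph D := (PointConfig.apply_mem_mapHomeomorph_iff _ _ _).2 hp
    have hq' : D q ∈ X.mapHomeomorph D := (PointConfig.apply_mem_mapHomeomorph_iff _ _ _).2 hq
    have key := h _ hp' _ hq' (fun e => hpq (D.injective e)) (by rwa [hwin, hwin])
    rw [norm_dilate_fst_sub hD, abs_of_pos hc] at key
    exact le_of_mul_le_mul_left key hc
  · intro h p' hp' q' hq' hpq hΛ
    obtain ⟨p, rfl⟩ := D.surjective p'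
    obtain ⟨q, rfl⟩ := D.surjective q'
    rw [PointConfig.apply_mem_mapHomeomorph_iff] at hp' hq'
    rw [hwin, hwin] at hΛ
    have key := h p hp' q hq' (fun e => hpq (by rw [e])) hΛ
    rw [norm_dilate_fst_sub hD, abs_of_pos hc]
    exact mul_le_mul_of_nonneg_left key hc.le

omit [Fintype d] in
/-- Membership in a window superposition (unfolding lemma). -/
theorem mem_superposeIn_iff' (Λ : Set (EuclideanSpace ℝ d)) {k : ℕ}
    (x : Fin k → EuclideanSpace ℝ d × EuclideanSpace ℝ d)
    (Y : PointConfig (EuclideanSpace ℝ d × EuclideanSpace ℝ d)) (p : EuclideanSpace ℝ d × EuclideanSpace ℝ d) :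
    p ∈ superposeIn Λ x Y ↔ (p ∈ Set.range x ∧ p.1 ∈ Λ) ∨ (p ∈ Y ∧ p.1 ∉ Λ) :=
  Iff.rfl

omit [Fintype d] in
/-- **Window superposition is dilation covariant**:
`(c x)_Λ ∪ (c Y)_{Λᶜ} = c (x_{c⁻¹Λ} ∪ Y_{(c⁻¹Λ)ᶜ})`. -/
theorem superposeIn_mapHomeomorph_dilate (hD : ∀ p, D p = (c • p.1, p.2)) (Λ : Set (EuclideanSpace ℝ d))
    {k : ℕ} (x : Fin k → EuclideanSpace ℝ d × EuclideanSpace ℝ d)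
    (Y : PointConfig (EuclideanSpace ℝ d × EuclideanSpace ℝ d)) :
    superposeIn Λ (fun i => D (x i)) (Y.mapHomeomorph D) = (superposeIn ((c • ·) ⁻¹' Λ) x Y).mapHomeomorph D := by
  have hwin : ∀ p : EuclideanSpace ℝ d × EuclideanSpace ℝ d, (D p).1 ∈ Λ ↔ p.1 ∈ (c • ·) ⁻¹' Λ :=
    fun p => by rw [hD]; rfl
  ext p'
  obtain ⟨p, rfl⟩ := D.surjective p'
  rw [PointConfig.apply_mem_mapHomeomorph_iff, mem_superposeIn_iff', mem_superposeIn_iff',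
    PointConfig.apply_mem_mapHomeomorph_iff, hwin]
  simp only [Set.mem_range, D.injective.eq_iff]

/-! ## The a-priori measure under dilation (Lebesgue scaling) -/

/-- The one-particle a-priori measure is σ-finite. -/
theorem sigmaFinite_maxwellPhaseMeasure' (β : ℝ) (u : EuclideanSpace ℝ d) (Λ : Set (EuclideanSpace ℝ d)) :
    SigmaFinite (maxwellPhaseMeasure β u Λ) := by
  unfold maxwellPhaseMeasure
  infer_instance

/-- **Lebesgue scaling of the a-priori measure**: `dq|_Λ ⊗ M_β(v-u)dv` is `|c|^d` times the image
under the dilation of `dq|_{c⁻¹Λ} ⊗ M_β(v-u)dv` (checked on measurable rectangles, `Measure.prod_eq`,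
with `Measure.addHaar_preimage_smul` for the position factor). -/
theorem maxwellPhaseMeasure_eq_smul_map_dilate (hc : c ≠ 0) (hD : ∀ p, D p = (c • p.1, p.2)) (β : ℝ)
    (u : EuclideanSpace ℝ d) (Λ : Set (EuclideanSpace ℝ d)) :
    maxwellPhaseMeasure β u Λ =
      ENNReal.ofReal |c ^ Module.finrank ℝ (EuclideanSpace ℝ d)| •
        (maxwellPhaseMeasure β u ((c • ·) ⁻¹' Λ)).map D := by
  unfold maxwellPhaseMeasure
  refine Measure.prod_eq fun S T hS hT => ?_
  rw [Measure.smul_apply, Measure.map_apply D.measurable (hS.prod hT), smul_eq_mul]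
  have hpre : D ⁻¹' (S ×ˢ T) = ((c • ·) ⁻¹' S) ×ˢ T := by
    ext p
    simp only [Set.mem_preimage, hD, Set.mem_prod]
  rw [hpre, Measure.prod_prod, Measure.restrict_apply (measurable_const_smul c hS),
    ← Set.preimage_inter, Measure.addHaar_preimage_smul volume hc, Measure.restrict_apply hS,
    ← mul_assoc, ← mul_assoc, ← ENNReal.ofReal_mul (abs_nonneg _), ← abs_mul,
    mul_inv_cancel₀ (pow_ne_zero _ hc), abs_one, ENNReal.ofReal_one, one_mul]

/-- **Lebesgue scaling of the `k`-particle a-priori measure**: the `k`-fold power of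
`dq|_Λ ⊗ M_β dv` is `|c|^{dk}` times the image under the coordinate-wise dilation
(`MeasurableEquiv.piCongrRight`) of the `k`-fold power of `dq|_{c⁻¹Λ} ⊗ M_β dv` (checked on boxes,
`Measure.pi_eq`). -/
theorem pi_maxwellPhaseMeasure_eq_smul_map_dilate (hc : c ≠ 0) (hD : ∀ p, D p = (c • p.1, p.2)) (β : ℝ)
    (u : EuclideanSpace ℝ d) (Λ : Set (EuclideanSpace ℝ d)) (k : ℕ) :
    (Measure.pi fun _ : Fin k => maxwellPhaseMeasure β u Λ) =
      ENNReal.ofReal |c ^ Module.finrank ℝ (EuclideanSpace ℝ d)| ^ k •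
        (Measure.pi fun _ : Fin k => maxwellPhaseMeasure β u ((c • ·) ⁻¹' Λ)).map
          (MeasurableEquiv.piCongrRight fun _ : Fin k => D.toMeasurableEquiv) := by
  haveI := fun Λ' : Set (EuclideanSpace ℝ d) => sigmaFinite_maxwellPhaseMeasure' β u Λ'
  refine Measure.pi_eq fun s hs => ?_
  rw [Measure.smul_apply, Measure.map_apply (MeasurableEquiv.measurable _) (MeasurableSet.univ_pi hs),
    smul_eq_mul]
  have hpre : (MeasurableEquiv.piCongrRight fun _ : Fin k => D.toMeasurableEquiv) ⁻¹' Set.pi univ s =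
      Set.pi univ fun i => D ⁻¹' (s i) := by
    ext x
    simp only [Set.mem_preimage, Set.mem_univ_pi]
    rfl
  rw [hpre, Measure.pi_pi]
  have hconst : ENNReal.ofReal |c ^ Module.finrank ℝ (EuclideanSpace ℝ d)| ^ k =
      ∏ _i : Fin k, ENNReal.ofReal |c ^ Module.finrank ℝ (EuclideanSpace ℝ d)| := by
    rw [Finset.prod_const, Finset.card_univ, Fintype.card_fin]
  rw [hconst, ← Finset.prod_mul_distrib]
  refine Finset.prod_congr rfl fun i _ => ?_
  rw [maxwellPhaseMeasure_eq_smul_map_dilate hc hD β u Λ, Measure.smul_apply,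
    Measure.map_apply D.measurable (hs i), smul_eq_mul]

/-! ## Dilation covariance of the grand-canonical weights and of the specification -/

/-- **The grand-canonical weights are dilation covariant** (`c > 0`): with the Jacobian `c^{dk}` of
the `k`-particle term absorbed into the activity,
`W^{cε, z}_Λ(A | cY) = W^{ε, cᵈ z}_{c⁻¹Λ}(c⁻¹A | Y)`. -/
theorem gibbsWeight_mapHomeomorph_dilate (hc : 0 < c) (hD : ∀ p, D p = (c • p.1, p.2)) (ε z β : ℝ)
    (u : EuclideanSpace ℝ d) (Λ : Set (EuclideanSpace ℝ d))
    (Y : PointConfig (EuclideanSpace ℝ d × EuclideanSpace ℝ d))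
    (A : Set (PointConfig (EuclideanSpace ℝ d × EuclideanSpace ℝ d))) :
    gibbsWeight (c * ε) z β u Λ (Y.mapHomeomorph D) A =
      gibbsWeight ε (c ^ Fintype.card d * z) β u ((c • ·) ⁻¹' Λ) Y (PointConfig.mapHomeomorph D ⁻¹' A) := by
  unfold gibbsWeight
  refine tsum_congr fun k => ?_
  rw [pi_maxwellPhaseMeasure_eq_smul_map_dilate hc.ne' hD β u Λ k, lintegral_smul_measure,
    lintegral_map_equiv, smul_eq_mul, ← mul_assoc]
  congr 1
  · rw [finrank_euclideanSpace, abs_of_pos (pow_pos hc _), ← ENNReal.ofReal_pow (pow_nonneg hc.le _),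
      mul_comm, ← ENNReal.ofReal_mul (pow_nonneg (pow_nonneg hc.le _) _), mul_pow, mul_div_assoc]
  · refine lintegral_congr fun x => ?_
    rw [show (⇑(MeasurableEquiv.piCongrRight fun _ : Fin k => D.toMeasurableEquiv) x) = fun i => D (x i)
      from rfl, superposeIn_mapHomeomorph_dilate hD]
    by_cases hmem : (superposeIn ((c • ·) ⁻¹' Λ) x Y).mapHomeomorph D ∈ A ∩ {X | HardCoreIn (c * ε) Λ X}
    · have hmem' : superposeIn ((c • ·) ⁻¹' Λ) x Y ∈
          PointConfig.mapHomeomorph D ⁻¹' A ∩ {X | HardCoreIn ε ((c • ·) ⁻¹' Λ) X} :=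
        ⟨hmem.1, (hardCoreIn_mapHomeomorph_dilate_iff hc hD ε Λ _).1 hmem.2⟩
      rw [indicator_of_mem hmem, indicator_of_mem hmem']
      rfl
    · have hmem' : superposeIn ((c • ·) ⁻¹' Λ) x Y ∉
          PointConfig.mapHomeomorph D ⁻¹' A ∩ {X | HardCoreIn ε ((c • ·) ⁻¹' Λ) X} :=
        fun h' => hmem ⟨h'.1, (hardCoreIn_mapHomeomorph_dilate_iff hc hD ε Λ _).2 h'.2⟩
      rw [indicator_of_notMem hmem, indicator_of_notMem hmem']

/-- **The specification is dilation covariant**: `γ^{cε,z}_Λ(A | cY) = γ^{ε,cᵈz}_{c⁻¹Λ}(c⁻¹A | Y)`. -/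
theorem gibbsSpec_mapHomeomorph_dilate (hc : 0 < c) (hD : ∀ p, D p = (c • p.1, p.2)) (ε z β : ℝ)
    (u : EuclideanSpace ℝ d) (Λ : Set (EuclideanSpace ℝ d))
    (Y : PointConfig (EuclideanSpace ℝ d × EuclideanSpace ℝ d))
    (A : Set (PointConfig (EuclideanSpace ℝ d × EuclideanSpace ℝ d))) :
    gibbsSpec (c * ε) z β u Λ (Y.mapHomeomorph D) A =
      gibbsSpec ε (c ^ Fintype.card d * z) β u ((c • ·) ⁻¹' Λ) Y (PointConfig.mapHomeomorph D ⁻¹' A) := by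
  unfold gibbsSpec
  rw [gibbsWeight_mapHomeomorph_dilate hc hD, gibbsWeight_mapHomeomorph_dilate hc hD, Set.preimage_univ]

/-- Dilated windows of bounded windows are bounded. -/
theorem isBounded_preimage_smul (hc : c ≠ 0) {Λ : Set (EuclideanSpace ℝ d)} (hb : Bornology.IsBounded Λ) :
    Bornology.IsBounded ((c • ·) ⁻¹' Λ) := by
  rw [Set.preimage_smul₀ hc]
  exact hb.smul₀ c⁻¹

/-! ## Gibbs states and translation invariance under dilation -/

/-- **Dilation of hard-sphere Gibbs states**: if `μ` is a Gibbs (DLR) state of the hard-sphere gas of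
diameter `ε`, activity `cᵈ z`, inverse temperature `β`, drift `u`, then its image under the spatial
dilation `x ↦ c x` (`c > 0`) is a Gibbs state of diameter `c ε` and activity `z` (same `β`, `u`): the
DLR equation of the image in the window `Λ` is the DLR equation of `μ` in `c⁻¹Λ`, by
`gibbsSpec_mapHomeomorph_dilate` and the change of variables `Y ↦ cY`. -/
theorem isHardSphereGibbs_map_dilate (hc : 0 < c) (hD : ∀ p, D p = (c • p.1, p.2)) {ε z β : ℝ}
    {u : EuclideanSpace ℝ d} {μ : Measure (PointConfig (EuclideanSpace ℝ d × EuclideanSpace ℝ d))}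
    (hμ : IsHardSphereGibbs ε (c ^ Fintype.card d * z) β u μ) :
    IsHardSphereGibbs (c * ε) z β u (μ.map (PointConfig.mapHomeomorph D)) := by
  haveI := hμ.1
  have hmeas : Measurable (PointConfig.mapHomeomorph D : PointConfig (EuclideanSpace ℝ d × EuclideanSpace ℝ d) →
      PointConfig (EuclideanSpace ℝ d × EuclideanSpace ℝ d)) :=
    PointConfig.measurable_mapHomeomorph _
  refine ⟨Measure.isProbabilityMeasure_map hmeas.aemeasurable, fun Λ hΛ hb A hA => ?_⟩
  rw [Measure.map_apply hmeas hA,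
    hμ.2 _ (measurable_const_smul c hΛ) (isBounded_preimage_smul hc.ne' hb) _ (hA.preimage hmeas),
    show (PointConfig.mapHomeomorph D : PointConfig (EuclideanSpace ℝ d × EuclideanSpace ℝ d) →
        PointConfig (EuclideanSpace ℝ d × EuclideanSpace ℝ d)) = ⇑(PointConfig.mapHomeomorphEquiv D)
      from rfl,
    lintegral_map_equiv]
  refine lintegral_congr fun Y => ?_
  rw [PointConfig.coe_mapHomeomorphEquiv]
  exact (gibbsSpec_mapHomeomorph_dilate hc hD ε z β u Λ Y A).symm

/-- **Dilation of hard-sphere Gibbs states in `ℝ³`** (REGISTERED helper stub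
`isHardSphereGibbs_map_dilate_fin3` of F1 `stub_diluteGibbsDensityOne`, line `birth`, crux
stmt-AtomisticToContinuum-9584): for every homeomorphism `D` of `ℝ³ × ℝ³` acting as the spatial
dilation `(q, v) ↦ (c q, v)` (`c > 0`), the image under `D` of a Gibbs state of the hard-sphere gas in
`ℝ³` of diameter `ε` and activity `c³ z` is a Gibbs state of diameter `c ε` and activity `z` (same
inverse temperature and drift) — the case `d = Fin 3` of `isHardSphereGibbs_map_dilate`. -/
theorem isHardSphereGibbs_map_dilate_fin3 :
    ∀ (c : ℝ), 0 < c →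
      ∀ D : EuclideanSpace ℝ (Fin 3) × EuclideanSpace ℝ (Fin 3) ≃ₜ EuclideanSpace ℝ (Fin 3) × EuclideanSpace ℝ (Fin 3),
        (∀ p, D p = (c • p.1, p.2)) →
          ∀ (ε z β : ℝ) (u : EuclideanSpace ℝ (Fin 3))
            (μ : Measure (PointConfig (EuclideanSpace ℝ (Fin 3) × EuclideanSpace ℝ (Fin 3)))),
            IsHardSphereGibbs ε (c ^ 3 * z) β u μ →
              IsHardSphereGibbs (c * ε) z β u (μ.map (PointConfig.mapHomeomorph D)) := by
  intro c hc D hD ε z β u μ hμ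
  refine isHardSphereGibbs_map_dilate hc hD ?_
  rwa [Fintype.card_fin]

/-- **Dilation of hard-sphere Gibbs states**, activity divided by the Jacobian: the image under
`x ↦ c x` of a Gibbs state of diameter `ε` and activity `z` is a Gibbs state of diameter `c ε` and
activity `z / cᵈ`. -/
theorem _root_.Literature.Analysis.FluidPDE.IsHardSphereGibbs.map_dilate (hc : 0 < c)
    (hD : ∀ p, D p = (c • p.1, p.2)) {ε z β : ℝ} {u : EuclideanSpace ℝ d}
    {μ : Measure (PointConfig (EuclideanSpace ℝ d × EuclideanSpace ℝ d))} (hμ : IsHardSphereGibbs ε z β u μ) :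
    IsHardSphereGibbs (c * ε) (z / c ^ Fintype.card d) β u (μ.map (PointConfig.mapHomeomorph D)) := by
  refine isHardSphereGibbs_map_dilate hc hD ?_
  rwa [mul_div_cancel₀ _ (pow_ne_zero _ hc.ne')]

/-- Dilation commutes with spatial translation up to rescaling the shift:
`c (Y + (c⁻¹a, 0)) = c Y + (a, 0)`. -/
theorem mapHomeomorph_dilate_translate (hc : c ≠ 0) (hD : ∀ p, D p = (c • p.1, p.2)) (a : EuclideanSpace ℝ d)
    (Y : PointConfig (EuclideanSpace ℝ d × EuclideanSpace ℝ d)) :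
    (Y.translate ((c⁻¹ • a, 0) : EuclideanSpace ℝ d × EuclideanSpace ℝ d)).mapHomeomorph D =
      (Y.mapHomeomorph D).translate ((a, 0) : EuclideanSpace ℝ d × EuclideanSpace ℝ d) := by
  rw [PointConfig.mapHomeomorph_translate D (dilate_add hD)]
  congr 1
  rw [hD, smul_smul, mul_inv_cancel₀ hc, one_smul]

/-- **Dilation preserves translation invariance**: if `μ` is invariant under all spatial shifts, so is
its image under `x ↦ c x` (the shift by `a` downstairs is the shift by `c⁻¹ a` upstairs). -/
theorem isTranslationInvariant_map_dilate (hc : c ≠ 0) (hD : ∀ p, D p = (c • p.1, p.2))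
    {μ : Measure (PointConfig (EuclideanSpace ℝ d × EuclideanSpace ℝ d))} (h : IsTranslationInvariant μ) :
    IsTranslationInvariant (μ.map (PointConfig.mapHomeomorph D)) := by
  intro a
  have hmeas : Measurable (PointConfig.mapHomeomorph D : PointConfig (EuclideanSpace ℝ d × EuclideanSpace ℝ d) →
      PointConfig (EuclideanSpace ℝ d × EuclideanSpace ℝ d)) :=
    PointConfig.measurable_mapHomeomorph _
  have hcomm : PointConfig.translate ((a, 0) : EuclideanSpace ℝ d × EuclideanSpace ℝ d) ∘ PointConfig.mapHomeomorph D =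
      PointConfig.mapHomeomorph D ∘
        PointConfig.translate ((c⁻¹ • a, 0) : EuclideanSpace ℝ d × EuclideanSpace ℝ d) := by
    funext Y
    exact (mapHomeomorph_dilate_translate hc hD a Y).symm
  rw [Measure.map_map (PointConfig.measurable_translate _) hmeas, hcomm,
    ← Measure.map_map hmeas (PointConfig.measurable_translate _), h (c⁻¹ • a)]

end Summit.AtomisticToContinuum.HydrodynamicLimit.Theorems.MourreKoopmanChargesStressStrongMixing

end
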